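/-
Copyright (c) 2026 the pub-hodgecm-mathlib formalisation cell (harness21).  R90-TF SLAB, section S10 (Rogawski 1990, Ch. 13.5–13.8 comparison engine read at `v`),
prover R90-C138-p02 (g0) — card 6a (dealer R90-C138-plan (g2) DEAL #7 + RULINGS J-6b-1, J-6b-2; R90-C138-typ3 (g2) ASK 1): ★ `MemberFlathLetter` FROM p03's ★ letter
`ArchFinSplitG3Letter` (6a₁ being PAID by ★ `hasFinComponent_memberFinModel`); h413 = `stmt-HodgeConjecture-24833`, route `HCCMUnconditional`.
-/
import Summits.HodgeConjecture.HodgeConjecture.Theorems.R90S10MemberFlathOfArchSplit     -- ★ p863799 (this seat, 6a₀): `memberFlath_of_archData`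
import Summits.HodgeConjecture.HodgeConjecture.Theorems.R90S10MemberFinComponent        -- ★ (this seat, 6a₁ PAID): `hasFinComponent_memberFinModel`
import Summits.HodgeConjecture.HodgeConjecture.Theorems.R90S10ArchFinSplitG3LetterDefs    -- ★ p863626 (R90-C138-p03): the 6b letter `ArchFinSplitG3Letter L`
import Summits.HodgeConjecture.HodgeConjecture.Theorems.R90S10LevelCutGOfRow3Flath        -- ★ p863479 (this seat): `MemberFlathLetter`, head `levelCutG_of_row3_flath`
import Summits.HodgeConjecture.HodgeConjecture.Theorems.R90S10Row3OfResidualCompactR      -- ★ p863355 (this seat): `exists_isAutomorphicMeasure_G3`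
import Summits.HodgeConjecture.HodgeConjecture.Theorems.K2E1FlathRestrictedLevel          -- ★ `isLevel_F`, `hasCompactSupport_F`, `isOpen_level`, `isCompact_level`
import Summits.HodgeConjecture.HodgeConjecture.Theorems.F0P3bCharIdentityTransport        -- ★ `smoothTrace_comp_continuousMulEquiv`
import Summits.HodgeConjecture.HodgeConjecture.Theorems.F0P3cStCharTSScTracePackage       -- ★ `nonarchimedeanGroup_Gqs`
import Summits.HodgeConjecture.HodgeConjecture.Theorems.F0P2cStubCLLocalTypeExists        -- ★ `isIrreducible_comp_mulEquiv`
import Literature.NumberTheory.Automorphic.UnitaryGroupPureTensorContinuity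
import Literature.NumberTheory.Automorphic.UnitaryGroupLocalTypeSpherical
import Literature.NumberTheory.Automorphic.RestrictedTensorProductAdmissibleProofs         -- ★ `IsRestrictedTensorProductRep.isAdmissible_holds`
import Literature.NumberTheory.Automorphic.RestrictedTensorProductIrreducibleProofs        -- ★ `IsRestrictedTensorProductRep.isIrreducible_holds`
import Literature.NumberTheory.Automorphic.LocalUnitaryGroupCongrMeasure                   -- ★ `isAdmissible_comp_continuousMulEquiv`
import Literature.NumberTheory.Automorphic.UnitaryGroupArchTopology                        -- ★ instances on `U(Φ)(F ⊗ ℝ)` (second countable, locally compact, Borel)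
import Literature.NumberTheory.Automorphic.UnitaryGroupAdelicProductHaar                   -- ★ `sFinite_haar_finAdelic`, product-Haar instances for `adelicProdEquiv`
import HarnessLib

/-!
# R90-TF ∕ S10 — card 6a: `MemberFlathLetter 𝔥 𝔳` FROM THE 6b LETTER `ArchFinSplitG3Letter L` (6a₁ PAID)
# (`Theorems/R90S10MemberFlathOfLetter.lean`; ns `Summit.HodgeConjecture.HodgeConjecture.R90.S10`; DEAL #7 + RULINGS J-6b-1 ∕ J-6b-2 of R90-C138-plan (g2); typ3 (g2) ASK 1, 2026-09-05)

Cell `hodgecm-mathlib`, crux H413 (`stmt-HodgeConjecture-24833`), route of record `HCCMUnconditional`; programme R90-TF, section S10 (base `R90-C138`).  PROOF lane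
(`--kind proof --supports stmt-HodgeConjecture-24833 --as helper`): nine theorems; no `def`, no instance, no notation, no named fact, no `sorry`; imports ★ only (law L9);
default heartbeats.

THE CHAIN OF RECORD (A2d `sock_S10_levelCutG`, `Lines/R90_S10_SimpleTF1383A.lean` :311–:342): A2d ⟸ ★ `levelCutG_of_row3_flath` (p863479) ⟸ {`Row3G3Letter L`
(★-paid modulo E1 12R3), `MemberFlathLetter … 𝔥 𝔳`}.  THIS FILE pays `MemberFlathLetter … 𝔥 𝔳` FROM EXACTLY ONE NAMED LETTER:
* 6b = R90-C138-p03's ★ `ArchFinSplitG3Letter L` (`Theorems/R90S10ArchFinSplitG3LetterDefs.lean`, p863626; payer E1b∕S2): for every discrete `P` of `U(Φ₃)` an irreducible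
  unitary `ϖ = π_∞` with, for each arch-smooth `f_∞`, a scalar `Θ = Θ_{π_∞}(f_∞)` (`HasArchOpTrace`) splitting the class trace `Tr [P](f_∞ ⊗ Λ) = Θ · Tr σf(Λ)` for EVERY
  irreducible admissible smooth finite component `σf` of `P` — at the product normalisation `νG = (adelicProdEquiv)⁻¹_* (νGi ⊗ νfA)`;
the finite guard 6a₁ of RULING J-6b-2 («some representative of every `S10MemG`-class carries the canonical model `memberFinModel 𝔳 πc _ ∘ ẽ` as finite component»,
ẽ = ★ `memberFinAdelicEquiv 𝔳`) being PAID by ★ `hasFinComponent_memberFinModel` (`Theorems/R90S10MemberFinComponent.lean`, this seat: Flath's factorisation + gluing).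
GLUE (`memberFlath_of_archFinSplitG3Letter`): at a member, instantiate 6b at that representative and at `σf :=` model ∘ ẽ (irreducible + admissible: ★
`IsRestrictedTensorProductRep.isIrreducible_holds` ∕ `isAdmissible_holds` on the representative slots, transported along ẽ), `fi := 𝔳.fGi`, `Λ := (φ ⊗ 𝟙_{K^v}) ∘ ẽ`
(locally constant, compactly supported: ★ `K2E1FlathRestrictedLevel` at `S = {v}`), `F := 𝔳.ΦG φ` (the factorisation `hF` is ★ `S10Frozen.hΦG` read through the pin ★
`memberFinAdelicEquiv_apply` + ★ `localPiEquiv_evalPlace_finPart`); the finite trace is carried back to `∏'_w (G_w : K_w)` by ★ `smoothTrace_comp_continuousMulEquiv` once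
`ẽ_* νfA = 𝔳.νf` (`νfA := ẽ⁻¹_* 𝔳.νf`); the data are fed to ★ `memberFlath_of_archData` (p863799).  MEASURES (head `memberFlathLetter_of_archFinSplitG3Letter (h6b)`, typ3 (g2)
ASK 1 01:01:06Z with 6a₁ discharged): `μG :=` ★ `exists_isAutomorphicMeasure_G3`; `𝔳.νf` IS a Haar measure (`isHaarMeasure_frozen_νf`: left invariant + finite on compacts by ★
`S10Frozen`'s fields, positive on the compact open level by (B4) `𝔳.hνf (K_v)`), hence so are `νfA` and `νG := (adelicProdEquiv)⁻¹_* (𝔥.νGi ⊗ νfA)` (Mathlib transport ∕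
product instances, ★ `sFinite_haar_finAdelic`); `U(Φ₃)(𝔸_f)` carries its Borel σ-algebra inside the proof (no measurable-space binder on the head).
So A2d's residual NAMED inputs after this file are exactly {E1 12R3 (`Row3G3Letter L`), 6b `ArchFinSplitG3Letter L` (E1b∕S2)}.
[Rogawski1990, §13.8 p. 218 L22–L28, p. 219 L1–L3; FlathCorvallis1979 Thm. 3, Thm. 4; BorelJacquet1979 §4.1, §4.3, §4.6; Bump1997 §3.3–§3.4; CasselsFrohlich1967 Ch. XV §3]
HONEST LABEL: closes no socket; 6b is an OPEN named letter and 12R3 is E1's open input; HC_CM is proved only modulo the 7 printed citations (2 remaining named inputs: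
hLiu418 = `stmt-HodgeConjecture-24832`, h413 = `stmt-HodgeConjecture-24833`) until rung 0 closes; REL ≠ ★ ≠ BUILT; count-neutral.

## References
* [Rogawski1990] J. D. Rogawski, *Automorphic Representations of Unitary Groups in Three Variables*, Ann. of Math. Stud. 123 (1990), §13.8 pp. 218–219.
* [FlathCorvallis1979] D. Flath, *Decomposition of representations into tensor products*, PSPM 33.1 (1979), Thm. 3, Thm. 4.
* [BorelJacquet1979] A. Borel, H. Jacquet, *Automorphic forms and automorphic representations*, PSPM 33.1 (1979), §4.1, §4.3, §4.6.
* [Bump1997] D. Bump, *Automorphic Forms and Representations* (1997), §3.3 Prop. 3.3.2, §3.4.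
* [CasselsFrohlichANT1967] J. W. S. Cassels, A. Fröhlich (eds.), *Algebraic Number Theory* (1967), Ch. XV (Tate), §3.
* [Knapp1986] A. Knapp, *Representation Theory of Semisimple Groups* (1986), Thm. 10.2.
-/

set_option autoImplicit false
set_option linter.dupNamespace false

noncomputable section

open scoped RestrictedProduct Matrix MatrixGroups
open Filter MeasureTheory NumberField IsDedekindDomain CompactlySupported
open Literature.NumberTheory.Rogawski1990 Literature.NumberTheory.Automorphic Literature.NumberTheory.Automorphic.UnitaryGroup
open Literature.NumberTheory.Automorphic.UnitaryGroup.CotangentForms Literature.NumberTheory.GaloisRepresentations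
open Literature.NumberTheory.Automorphic.Arthur2013.Leaves.TECR
open Summit.HodgeConjecture.HodgeConjecture.Cruxes.H413
open Summit.HodgeConjecture.HodgeConjecture.Cruxes.H413.K2E1TraceFormulaBeta
open Summit.HodgeConjecture.HodgeConjecture.Cruxes.H413.K2E1SpectralTermsDiscreteHalf
open Summit.HodgeConjecture.HodgeConjecture.Cruxes.H413.K2E1bGKCohomologyU21.U8 (HasArchOpTrace)

namespace Summit.HodgeConjecture.HodgeConjecture.R90.S10

/-! ## §1 Test functions `φ ⊗ 𝟙_{K^{i₀}}` on a restricted product -/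

section Generic

variable {ι : Type} [DecidableEq ι] {G : ι → Type} [∀ i, Group (G i)] (K : ∀ i, Subgroup (G i)) (i₀ : ι)

omit [DecidableEq ι] in
/-- `∏ᶠ_{i ≠ i₀} 𝟙_{K_i}(g_i) = 𝟙_{{∀ i ≠ i₀, g_i ∈ K_i}}(g)` on a restricted product (finitely many factors differ from `1`). -/
theorem finprod_indicator_eq_indicator (g : Πʳ i, [G i, K i]) :
    (∏ᶠ i : {i : ι // i ≠ i₀}, Set.indicator (K i.1 : Set (G i.1)) (fun _ => (1 : ℂ)) (g i.1)) =
      Set.indicator {g : Πʳ i, [G i, K i] | ∀ i, i ≠ i₀ → g i ∈ K i} (fun _ => (1 : ℂ)) g := by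
  classical
  by_cases h : ∀ i, i ≠ i₀ → g i ∈ K i
  · rw [Set.indicator_of_mem (show g ∈ {g : Πʳ i, [G i, K i] | ∀ i, i ≠ i₀ → g i ∈ K i} from h)]
    exact finprod_eq_one_of_forall_eq_one fun i => Set.indicator_of_mem (h i.1 i.2) _
  · rw [Set.indicator_of_notMem (show g ∉ {g : Πʳ i, [G i, K i] | ∀ i, i ≠ i₀ → g i ∈ K i} from h)]
    push Not at h
    obtain ⟨i, hi, hgi⟩ := h
    have hcof : {j : ι | ¬ (g j ∈ K j)}.Finite := Filter.eventually_cofinite.1 g.2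
    have hfin : (Function.mulSupport fun i : {i : ι // i ≠ i₀} => Set.indicator (K i.1 : Set (G i.1)) (fun _ => (1 : ℂ)) (g i.1)).Finite := by
      refine (hcof.preimage Subtype.val_injective.injOn).subset fun j hj => ?_
      simp only [Function.mem_mulSupport, ne_eq, Set.mem_preimage, Set.mem_setOf_eq] at hj ⊢
      intro hmem
      exact hj (Set.indicator_of_mem hmem _)
    exact finprod_eq_zero _ ⟨i, hi⟩ (Set.indicator_of_notMem hgi _) hfin

/-- The test function `φ ⊗ 𝟙_{K^{i₀}}` on a restricted product in the «level `F`» shape of ★ `K2E1FlathRestrictedLevel` (`S = {i₀}`, factors `φ` at `i₀` and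
`𝟙_{K_i}` elsewhere). -/
theorem tensorUnit_eq_F (φ : G i₀ → ℂ) (g : Πʳ i, [G i, K i]) :
    φ (g i₀) * Set.indicator {g : Πʳ i, [G i, K i] | ∀ i, i ≠ i₀ → g i ∈ K i} (fun _ => (1 : ℂ)) g =
      (∏ i ∈ ({i₀} : Finset ι), Function.update (fun i => Set.indicator (K i : Set (G i)) (fun _ => (1 : ℂ))) i₀ φ i (g i)) *
        Set.indicator {g : Πʳ i, [G i, K i] | ∀ i, i ∉ ({i₀} : Finset ι) → g i ∈ K i} (fun _ => (1 : ℂ)) g := by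
  rw [Finset.prod_singleton, Function.update_self]
  have hset : {g : Πʳ i, [G i, K i] | ∀ i, i ∉ ({i₀} : Finset ι) → g i ∈ K i} = {g : Πʳ i, [G i, K i] | ∀ i, i ≠ i₀ → g i ∈ K i} := by
    ext x
    simp only [Set.mem_setOf_eq, Finset.mem_singleton]
  rw [hset]

variable [∀ i, TopologicalSpace (G i)]

/-- `φ ⊗ 𝟙_{K^{i₀}}` is locally constant and compactly supported on the restricted product, for `φ` with a level and compact support and compact open `K_i`
(★ `K2E1FlathRestrictedLevel.isLevel_F` ∕ `hasCompactSupport_F`). -/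
theorem isLocSmooth_tensorUnit [∀ i, IsTopologicalGroup (G i)] [∀ i, T2Space (G i)]
    (hKo : ∀ i, IsOpen (K i : Set (G i))) (hKc : ∀ i, IsCompact (K i : Set (G i)))
    {φ : G i₀ → ℂ} (hφ : HasCompactSupport φ) {K' : Subgroup (G i₀)} (hK' : IsLevel K' φ) :
    IsLocSmooth (fun g : Πʳ i, [G i, K i] => φ (g i₀) * Set.indicator {g : Πʳ i, [G i, K i] | ∀ i, i ≠ i₀ → g i ∈ K i} (fun _ => (1 : ℂ)) g) := by
  classical
  haveI : Fact (∀ i, IsOpen (K i : Set (G i))) := ⟨hKo⟩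
  let f : ∀ i, G i → ℂ := Function.update (fun i => Set.indicator (K i : Set (G i)) (fun _ => (1 : ℂ))) i₀ φ
  let Kf : ∀ i, Subgroup (G i) := Function.update K i₀ K'
  have hf : ∀ i, HasCompactSupport (f i) := by
    intro i
    by_cases hi : i = i₀
    · subst hi; simp only [f, Function.update_self]; exact hφ
    · simp only [f, Function.update_of_ne hi]
      exact HasCompactSupport.intro (hKc i) fun x hx => Set.indicator_of_notMem hx _
  have hKf : ∀ i, IsLevel (Kf i) (f i) := by
    intro i
    by_cases hi : i = i₀
    · subst hi; simp only [f, Kf, Function.update_self]; exact hK'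
    · simp only [f, Kf, Function.update_of_ne hi]
      exact IsLevel.indicator (hKo i) (hKc i)
  have heq : (fun g : Πʳ i, [G i, K i] => φ (g i₀) * Set.indicator {g : Πʳ i, [G i, K i] | ∀ i, i ≠ i₀ → g i ∈ K i} (fun _ => (1 : ℂ)) g) =
      fun g : Πʳ i, [G i, K i] => (∏ i ∈ ({i₀} : Finset ι), f i (g i)) *
        Set.indicator {g : Πʳ i, [G i, K i] | ∀ i, i ∉ ({i₀} : Finset ι) → g i ∈ K i} (fun _ => (1 : ℂ)) g :=
    funext fun g => tensorUnit_eq_F K i₀ φ g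
  rw [heq]
  exact ⟨(K2E1FlathRestrictedLevel.isLevel_F {i₀} Kf hKo hKc hKf).isLocallyConstant,
    K2E1FlathRestrictedLevel.hasCompactSupport_F {i₀} hKc hf⟩

end Generic

/-! ## §2 The glue: measures, the per-member package from the 6b letter, the letter `MemberFlathLetter` -/

section Glue

variable {L : Type} [Field L] [NumberField L] [IsCMField L] [DecidableEq (Pl L)] {μ : HeckeCharacter L} {v : Pl L}
  [MeasurableSpace (HLoc L v)] [BorelSpace (HLoc L v)] [MeasurableSpace (Gqs L v)] [BorelSpace (Gqs L v)]
  {νHv : Measure (HLoc L v)} {νQv : Measure (Gqs L v)} [νHv.IsHaarMeasure] [νHv.IsMulRightInvariant] [νQv.IsHaarMeasure] [νQv.IsMulRightInvariant]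
  [∀ a : HLoc L v, MeasurableSpace (HLoc L v ⧸ Subgroup.centralizer ({a} : Set (HLoc L v)))]
  [∀ a : HLoc L v, BorelSpace (HLoc L v ⧸ Subgroup.centralizer ({a} : Set (HLoc L v)))]
  [∀ γ : Gqs L v, MeasurableSpace (Gqs L v ⧸ Subgroup.centralizer ({γ} : Set (Gqs L v)))]
  [∀ γ : Gqs L v, BorelSpace (Gqs L v ⧸ Subgroup.centralizer ({γ} : Set (Gqs L v)))]
  {mHv : OrbitalMeasureFamily (HLoc L v)} {mQv : OrbitalMeasureFamily (Gqs L v)} {πSt : IrrClass (HLoc L v)}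
  [MeasurableSpace (G3 L).Adelic] [BorelSpace (G3 L).Adelic] [MeasurableSpace (H2 L).Adelic] [BorelSpace (H2 L).Adelic]
  [MeasurableSpace (GArch L)] [BorelSpace (GArch L)] [MeasurableSpace (HArch L)] [BorelSpace (HArch L)]
  [MeasurableSpace (H1Loc L v)] [MeasurableSpace (H1Arch L)] [MeasurableSpace (H1 L).Adelic] [BorelSpace (H1 L).Adelic]
  [MeasurableSpace (finAdelic (↥(maximalRealSubfield L)) L (IsCMField.complexConj L) 3 (qsForm L))]
  [BorelSpace (finAdelic (↥(maximalRealSubfield L)) L (IsCMField.complexConj L) 3 (qsForm L))]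

omit [MeasurableSpace (G3 L).Adelic] [BorelSpace (G3 L).Adelic]
  [MeasurableSpace (finAdelic (↥(maximalRealSubfield L)) L (IsCMField.complexConj L) 3 (qsForm L))]
  [BorelSpace (finAdelic (↥(maximalRealSubfield L)) L (IsCMField.complexConj L) 3 (qsForm L))] in
/-- The slots of the canonical model are spherical with non-zero base off `v`. -/
theorem eventually_isSpherical_memberSlot {𝔥 : S10HDatum L μ v νHv νQv mHv mQv πSt} (𝔳 : S10Frozen L μ v νHv νQv mHv mQv πSt 𝔥)
    (πc : ∀ w : Pl L, IrrClass (Gqs L w)) (hsph : ∀ w : Pl L, w ≠ v → (πc w).IsSpherical (𝔳.K w)) :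
    ∀ᶠ w in cofinite, (memberSlot πc w).ρ.IsSpherical (𝔳.K w) ∧ memberBase 𝔳 πc hsph w ≠ 0 := by
  refine Filter.eventually_of_mem (Set.finite_singleton v).compl_mem_cofinite fun w hw => ?_
  have hw : w ≠ v := by simpa using hw
  refine ⟨(IrrClass.isSpherical_mk _ _).1 ?_, (memberBase_spec 𝔳 πc hsph w hw).2.1⟩
  rw [mk_memberSlot]
  exact hsph w hw

omit [MeasurableSpace (G3 L).Adelic] [BorelSpace (G3 L).Adelic]
  [MeasurableSpace (finAdelic (↥(maximalRealSubfield L)) L (IsCMField.complexConj L) 3 (qsForm L))]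
  [BorelSpace (finAdelic (↥(maximalRealSubfield L)) L (IsCMField.complexConj L) 3 (qsForm L))] in
/-- **Tate's finite-adelic measure of the frozen datum IS a Haar measure**: `𝔳.νf` is left invariant and finite on compacts (fields of ★ `S10Frozen`), and gives the compact
open level `K = ∏_w K_w` the mass `νQv(K_v) ∈ (0, ∞)` ((B4) `𝔳.hνf` at `K′ := K_v`), so Mathlib's `isHaarMeasure_of_isCompact_nonempty_interior` applies.
[cite: CasselsFrohlichANT1967, Ch. XV (Tate) §3.3] [cite: Bump1997, §3.4] -/
theorem isHaarMeasure_frozen_νf {𝔥 : S10HDatum L μ v νHv νQv mHv mQv πSt} (𝔳 : S10Frozen L μ v νHv νQv mHv mQv πSt 𝔥) :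
    haveI := 𝔳.hKo; @Measure.IsHaarMeasure (Πʳ w : Pl L, [Gqs L w, 𝔳.K w]) _ _ 𝔳.msF 𝔳.νf := by
  classical
  haveI := 𝔳.hKo
  letI := 𝔳.msF
  haveI := 𝔳.bsF
  haveI := 𝔳.hνfl
  haveI := 𝔳.hνfc
  have hKo : ∀ w : Pl L, IsOpen (𝔳.K w : Set (Gqs L w)) := 𝔳.hKo.out
  -- the full level `K = {g | ∀ w, g_w ∈ K_w}` (★ `K2E1FlathRestrictedLevel` at `S = ∅`)
  set KF : Subgroup (Πʳ w : Pl L, [Gqs L w, 𝔳.K w]) :=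
    (Subgroup.pi Set.univ fun w => if w ∈ (∅ : Finset (Pl L)) then 𝔳.K w else 𝔳.K w).comap
      (RestrictedProduct.coeMonoidHom : (Πʳ w : Pl L, [Gqs L w, 𝔳.K w]) →* ∀ w, Gqs L w) with hKFdef
  have hKFo : IsOpen (KF : Set (Πʳ w : Pl L, [Gqs L w, 𝔳.K w])) := K2E1FlathRestrictedLevel.isOpen_level ∅ (fun w => 𝔳.K w) hKo hKo
  have hKFc : IsCompact (KF : Set (Πʳ w : Pl L, [Gqs L w, 𝔳.K w])) := K2E1FlathRestrictedLevel.isCompact_level ∅ (fun w => 𝔳.K w) 𝔳.hKc 𝔳.hKc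
  have hmem : ∀ g : Πʳ w : Pl L, [Gqs L w, 𝔳.K w], g ∈ (KF : Set (Πʳ w : Pl L, [Gqs L w, 𝔳.K w])) ↔ ∀ w, g w ∈ 𝔳.K w := fun g => by
    rw [SetLike.mem_coe, hKFdef, K2E1RestrictedTensorFixedLevel.mem_level_iff]
    simp
  -- its mass is `νQv(K_v)` by (B4)
  have hset : (KF : Set (Πʳ w : Pl L, [Gqs L w, 𝔳.K w])) = {g | g v ∈ 𝔳.K v ∧ ∀ w, w ≠ v → g w ∈ 𝔳.K w} := by
    ext g
    rw [hmem]
    refine ⟨fun h => ⟨h v, fun w _ => h w⟩, fun h w => ?_⟩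
    by_cases hw : w = v
    · subst hw; exact h.1
    · exact h.2 w hw
  have hreal : 𝔳.νf.real (KF : Set (Πʳ w : Pl L, [Gqs L w, 𝔳.K w])) = νQv.real (𝔳.K v : Set (Gqs L v)) := by
    rw [hset]; exact 𝔳.hνf (𝔳.K v) (hKo v) (𝔳.hKc v)
  have hpos : 0 < νQv.real (𝔳.K v : Set (Gqs L v)) :=
    ENNReal.toReal_pos ((hKo v).measure_pos νQv ⟨1, (𝔳.K v).one_mem⟩).ne' (𝔳.hKc v).measure_lt_top.ne
  have h0 : 𝔳.νf (KF : Set (Πʳ w : Pl L, [Gqs L w, 𝔳.K w])) ≠ 0 := by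
    intro h0
    rw [Measure.real, h0, ENNReal.toReal_zero] at hreal
    exact hpos.ne hreal
  exact Measure.isHaarMeasure_of_isCompact_nonempty_interior 𝔳.νf _ hKFc ⟨1, by rw [hKFo.interior_eq]; exact KF.one_mem⟩ h0 hKFc.measure_lt_top.ne

omit [MeasurableSpace (G3 L).Adelic] [BorelSpace (G3 L).Adelic] in
/-- Hence its transport `ẽ⁻¹_* 𝔳.νf` to `U(Φ₃)(𝔸_f)` (the `ν_𝔸f` fed to the 6b letter) is a Haar measure (Mathlib `ContinuousMulEquiv.isHaarMeasure_map`).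
[cite: CasselsFrohlichANT1967, Ch. XV (Tate) §3.3] -/
theorem isHaarMeasure_map_memberFinAdelicEquiv_symm {𝔥 : S10HDatum L μ v νHv νQv mHv mQv πSt} (𝔳 : S10Frozen L μ v νHv νQv mHv mQv πSt 𝔥) :
    (@Measure.map _ _ 𝔳.msF _ (⇑(memberFinAdelicEquiv 𝔳).symm) 𝔳.νf).IsHaarMeasure := by
  haveI := 𝔳.hKo
  letI := 𝔳.msF
  haveI := 𝔳.bsF
  haveI := isHaarMeasure_frozen_νf 𝔳
  exact ContinuousMulEquiv.isHaarMeasure_map 𝔳.νf (memberFinAdelicEquiv 𝔳).symm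

/-- **The product normalisation `νG := (adelicProdEquiv)⁻¹_* (𝔥.νGi ⊗ νfA)` IS a Haar measure on `U(Φ₃)(𝔸_{L⁺})`** for Haar `νfA` on `U(Φ₃)(𝔸_f)` (`𝔥.νGi` Haar by ★
`S10HDatum.hνGi`; Mathlib's `Measure.prod.instIsHaarMeasure` — second countability of `U(Φ)(F ⊗ ℝ)` from ★ `UnitaryGroupArchTopology`, `SFinite νfA` from ★
`sFinite_haar_finAdelic` — and `ContinuousMulEquiv.isHaarMeasure_map`): the `νG` of the 6b letter. [cite: BorelJacquet1979, §4.1] [cite: CasselsFrohlichANT1967, Ch. XV (Tate) §3.3] -/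
theorem isHaarMeasure_map_adelicProdEquiv_symm_prod (𝔥 : S10HDatum L μ v νHv νQv mHv mQv πSt)
    (νfA : Measure (finAdelic (↥(maximalRealSubfield L)) L (IsCMField.complexConj L) 3 (qsForm L))) [νfA.IsHaarMeasure] :
    (Measure.map (adelicProdEquiv (↥(maximalRealSubfield L)) L (IsCMField.complexConj L) 3 (qsForm L)).symm.toMulEquiv (𝔥.νGi.prod νfA)).IsHaarMeasure := by
  haveI := 𝔥.hνGi
  haveI : SFinite νfA := sFinite_haar_finAdelic (↥(maximalRealSubfield L)) L (IsCMField.complexConj L) 3 (qsForm L) νfA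
  haveI : (𝔥.νGi.prod νfA).IsHaarMeasure := Measure.prod.instIsHaarMeasure _ _
  exact ContinuousMulEquiv.isHaarMeasure_map (𝔥.νGi.prod νfA) (adelicProdEquiv (↥(maximalRealSubfield L)) L (IsCMField.complexConj L) 3 (qsForm L)).symm

/-- **THE PER-MEMBER PACKAGE ★ `S10MemberFlath … c πc` FROM THE 6b LETTER** (card 6a; RULINGS J-6b-1, J-6b-2).  For an `S10MemG`-member `(c, πc)` at `(μG, νG)` with
`νG = (adelicProdEquiv)⁻¹_* (𝔥.νGi ⊗ ẽ⁻¹_* 𝔳.νf)`: p03's ★ `ArchFinSplitG3Letter L`, instantiated at the representative `P` of `c` supplied by ★ `hasFinComponent_memberFinModel`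
(6a₁ PAID: `P.HasFinComponent (memberFinModel … ∘ ẽ)`, Flath), at `νfA := ẽ⁻¹_* 𝔳.νf` (Haar: `isHaarMeasure_map_memberFinAdelicEquiv_symm`), `fi := 𝔳.fGi` (arch-smooth: ★ `S10Frozen.hsmG`)
and `σf := memberFinModel … ∘ ẽ` (irreducible, admissible: ★ `IsRestrictedTensorProductRep.isIrreducible_holds` ∕ `isAdmissible_holds` on the representative slots — admissible
by ★ `isAdmissible_memberSlot` from `IsLinked`'s `HasLocalClasses`, spherical with non-zero base off `v` — then ★ `isIrreducible_comp_mulEquiv`, ★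
`isAdmissible_comp_continuousMulEquiv`), yields `ϖ = π_∞`, `Θ = Θ_{π_∞}(𝔳.fGi)` with `HasArchOpTrace`, and the split of `Tr c(F)` for every factorised `F = fi ⊗ Λ`.  At a
matched pair `(fH, φ)` take `Λ := (φ ⊗ 𝟙_{K^v}) ∘ ẽ` (`isLocSmooth_tensorUnit` + continuity of ẽ) and `F := 𝔳.ΦG φ` (★ `S10Frozen.hΦG` through the pin ★
`memberFinAdelicEquiv_apply` + ★ `localPiEquiv_evalPlace_finPart`, `finprod_indicator_eq_indicator`); the finite trace returns to `∏'_w (G_w : K_w)` by ★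
`smoothTrace_comp_continuousMulEquiv` since `ẽ_* νfA = 𝔳.νf`.  The result is fed to ★ `memberFlath_of_archData` (p863799).
[cite: Rogawski1990, §13.8 p. 218 L22–L28, p. 219 L1–L3] [cite: FlathCorvallis1979, Thm. 3 and Thm. 4] [cite: BorelJacquet1979, §4.3 and §4.6] [cite: Knapp1986, Thm. 10.2] -/
theorem memberFlath_of_archFinSplitG3Letter (h6b : ArchFinSplitG3Letter L)
    (𝔥 : S10HDatum L μ v νHv νQv mHv mQv πSt) (𝔳 : S10Frozen L μ v νHv νQv mHv mQv πSt 𝔥)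
    (μG : Measure (G3 L).automorphicQuotient) [(G3 L).IsAutomorphicMeasure μG]
    (c : DiscreteClass (G3 L) μG) (πc : ∀ w : Pl L, IrrClass (Gqs L w)) (hmem : S10MemG L μ v νHv νQv mHv mQv πSt 𝔥 𝔳 μG c πc)
    (νG : Measure (G3 L).Adelic) [νG.IsHaarMeasure]
    (hνG : νG = Measure.map (adelicProdEquiv (↥(maximalRealSubfield L)) L (IsCMField.complexConj L) 3 (qsForm L)).symm.toMulEquiv
      (𝔥.νGi.prod (@Measure.map _ _ 𝔳.msF _ (⇑(memberFinAdelicEquiv 𝔳).symm) 𝔳.νf))) :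
    Nonempty (S10MemberFlath L μ v νHv νQv mHv mQv πSt 𝔥 𝔳 μG νG c πc) := by
  classical
  -- structures of the frozen datum as local instances
  haveI := 𝔳.hKo
  letI := 𝔳.msF
  haveI := 𝔳.bsF
  haveI := 𝔳.hνfl
  haveI := 𝔳.hνfc
  haveI := 𝔥.hνGi
  haveI : ∀ w : Pl L, NonarchimedeanGroup (Gqs L w) := fun w => F0P3cStCharTSScTracePackage.nonarchimedeanGroup_Gqs L w
  have hsph : ∀ w : Pl L, w ≠ v → (πc w).IsSpherical (𝔳.K w) := fun w hw => (hmem.2 ⟨w, hw⟩).1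
  have hKo : ∀ w : Pl L, IsOpen (𝔳.K w : Set (Gqs L w)) := 𝔳.hKo.out
  -- the canonical model and its Flath properties
  set M := memberFinModel 𝔳 πc hsph with hMdef
  set eT := memberFinAdelicEquiv 𝔳 with heTdef
  set νfA : Measure (finAdelic (↥(maximalRealSubfield L)) L (IsCMField.complexConj L) 3 (qsForm L)) := Measure.map eT.symm 𝔳.νf with hνfAdef
  haveI : νfA.IsHaarMeasure := isHaarMeasure_map_memberFinAdelicEquiv_symm 𝔳
  obtain ⟨P, Wf, _, _, σf₀, hPc₀, -, hσf₀⟩ := hmem.1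
  have hirr : ∀ w, (memberSlot πc w).ρ.IsIrreducible := fun w => (memberSlot πc w).isIrreducible
  have hadm : ∀ w, (memberSlot πc w).ρ.IsAdmissible := fun w => isAdmissible_memberSlot πc hσf₀ w
  have hsphx := eventually_isSpherical_memberSlot 𝔳 πc hsph
  have hRTP := isRestrictedTensorProductRep_memberFinModel 𝔳 πc hsph
  have hirrM : M.IsIrreducible := IsRestrictedTensorProductRep.isIrreducible_holds hKo 𝔳.hKc hirr hadm hsphx hRTP
  have hadmM : M.IsAdmissible := IsRestrictedTensorProductRep.isAdmissible_holds hKo 𝔳.hKc hadm hsphx hRTP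
  haveI : M.IsIrreducible := hirrM
  have hirrσ : Representation.IsIrreducible (V := RestrictedTensorProduct ℂ (memberBase 𝔳 πc hsph)) (M.comp eT.toMulEquiv.toMonoidHom) :=
    F0P2cStubCLLocalTypeExists.isIrreducible_comp_mulEquiv M eT.toMulEquiv
  have hadmσ : Representation.IsAdmissible (V := RestrictedTensorProduct ℂ (memberBase 𝔳 πc hsph)) (M.comp eT.toMulEquiv.toMonoidHom) :=
    isAdmissible_comp_continuousMulEquiv hadmM eT
  -- the letter at the representative of the class carrying the model as finite component
  obtain ⟨P₁, hPc, hfin⟩ := hasFinComponent_memberFinModel 𝔳 μG c πc hmem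
  obtain ⟨E, _, _, _, ϖ, hu, hsc, hirri, hrest⟩ := h6b μG 𝔥.νGi νfA νG hνG P₁
  obtain ⟨Θ, hop, hsplit6⟩ := hrest 𝔳.fGi 𝔳.hsmG
  refine memberFlath_of_archData 𝔥 𝔳 μG νG c πc hmem Θ E ϖ hu hsc hirri hop fun fH φ hM => ?_
  -- the split at a matched pair
  have hφ : IsLocSmooth φ := hM.2.1
  obtain ⟨Kφ, hKφ⟩ := (K2E1Pinned1383InputsOfLocSmooth.hasCompactSupport_and_exists_isLevel_gqs L v φ hφ).2
  set Λ₀ : (Πʳ w : Pl L, [Gqs L w, 𝔳.K w]) → ℂ := fun g => φ (g v) *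
    Set.indicator {g : Πʳ w : Pl L, [Gqs L w, 𝔳.K w] | ∀ w, w ≠ v → g w ∈ 𝔳.K w} (fun _ => (1 : ℂ)) g with hΛ₀def
  have hΛ₀ : IsLocSmooth Λ₀ := isLocSmooth_tensorUnit (fun w => 𝔳.K w) v hKo 𝔳.hKc hφ.2 hKφ
  have hΛ : IsLocSmooth (Λ₀ ∘ eT) := ⟨hΛ₀.1.comp_continuous eT.continuous, hΛ₀.2.comp_homeomorph eT.toHomeomorph⟩
  have hcoord : ∀ (x : (G3 L).Adelic) (w : Pl L),
      (G3 L).toLocal w x = eT (UnitaryGroup.finPart (↥(maximalRealSubfield L)) L (IsCMField.complexConj L) 3 (qsForm L) x) w := fun x w => by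
    rw [heTdef, memberFinAdelicEquiv_apply]
    exact (localPiEquiv_evalPlace_finPart (↥(maximalRealSubfield L)) L (IsCMField.complexConj L) 3 (qsForm L) w x).symm
  have hF : ∀ x : (G3 L).Adelic, 𝔳.ΦG φ x =
      𝔳.fGi (UnitaryGroup.archPart (↥(maximalRealSubfield L)) L (IsCMField.complexConj L) 3 (qsForm L) x) *
        (Λ₀ ∘ eT) (UnitaryGroup.finPart (↥(maximalRealSubfield L)) L (IsCMField.complexConj L) 3 (qsForm L) x) := fun x => by
    rw [𝔳.hΦG φ hφ x]
    congr 1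
    simp only [Function.comp_apply, hΛ₀def, hcoord]
    rw [finprod_indicator_eq_indicator]
  have key := hsplit6 _ _ _ (M.comp eT.toMulEquiv.toMonoidHom) hirrσ hadmσ hadmσ.isSmooth hfin (Λ₀ ∘ eT) (𝔳.ΦG φ) hΛ hF
  -- transport the finite trace back to the restricted product
  have hmap : νfA.map eT = 𝔳.νf := by
    have hm₁ : Measurable (⇑eT) := eT.continuous.measurable
    have hm₂ : Measurable (⇑eT.symm) := eT.symm.continuous.measurable
    rw [hνfAdef, Measure.map_map hm₁ hm₂]
    have : (⇑eT ∘ ⇑eT.symm) = id := funext fun y => eT.apply_symm_apply y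
    rw [this, Measure.map_id]
  have htr : Representation.smoothTrace (M.comp eT.toMulEquiv.toMonoidHom) νfA (Λ₀ ∘ eT) = M.smoothTrace 𝔳.νf Λ₀ := by
    have h := F0P3bCharIdentityTransport.smoothTrace_comp_continuousMulEquiv M hadmM eT νfA Λ₀
    rw [hmap] at h
    exact h
  have key' : c.classTrace νG (𝔳.ΦG φ) = Θ * Representation.smoothTrace (M.comp eT.toMulEquiv.toMonoidHom) νfA (Λ₀ ∘ eT) := hPc ▸ key
  rw [key', htr]

omit [MeasurableSpace (finAdelic (↥(maximalRealSubfield L)) L (IsCMField.complexConj L) 3 (qsForm L))]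
  [BorelSpace (finAdelic (↥(maximalRealSubfield L)) L (IsCMField.complexConj L) 3 (qsForm L))] in
/-- **HEAD OF CARD 6 — ★ `MemberFlathLetter … 𝔥 𝔳` FROM THE 6b LETTER ALONE (`ArchFinSplitG3Letter L`, R90-C138-p03 ★ p863626; 6a₁ PAID by ★ `hasFinComponent_memberFinModel`).**
The normalised pair is `μG :=` an automorphic measure on `[U(Φ₃)]` (★ `exists_isAutomorphicMeasure_G3`) and `νG := (adelicProdEquiv)⁻¹_* (𝔥.νGi ⊗ ẽ⁻¹_* 𝔳.νf)` with
`U(Φ₃)(𝔸_f)` given its Borel σ-algebra (Haar: `isHaarMeasure_frozen_νf`, `isHaarMeasure_map_memberFinAdelicEquiv_symm`, `isHaarMeasure_map_adelicProdEquiv_symm_prod`);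
every member — contributing or not — then carries ★ `S10MemberFlath` by `memberFlath_of_archFinSplitG3Letter`.  With ★ `levelCutG_of_row3_flath` (p863479) A2d
`sock_S10_levelCutG` is thereby paid modulo exactly {`Row3G3Letter L` (E1 12R3), `ArchFinSplitG3Letter L` (6b, E1b∕S2)}; R90-C138-typ3 (g2)'s A ED. 5 (f) body for
`sock_S10_memberFlath` is the one name `memberFlathLetter_of_archFinSplitG3Letter (sock_S10_archFinSplitG3 L)`.
[cite: Rogawski1990, §13.8 p. 218 L22–L28, p. 219 L1–L3] [cite: FlathCorvallis1979, Thm. 3 and Thm. 4] [cite: BorelJacquet1979, §4.1, §4.3 and §4.6] [cite: Bump1997, §3.3 Prop. 3.3.2] -/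
theorem memberFlathLetter_of_archFinSplitG3Letter {𝔥 : S10HDatum L μ v νHv νQv mHv mQv πSt} {𝔳 : S10Frozen L μ v νHv νQv mHv mQv πSt 𝔥}
    (h6b : ArchFinSplitG3Letter L) : MemberFlathLetter L μ v νHv νQv mHv mQv πSt 𝔥 𝔳 := by
  classical
  letI : MeasurableSpace (finAdelic (↥(maximalRealSubfield L)) L (IsCMField.complexConj L) 3 (qsForm L)) := borel _
  haveI : BorelSpace (finAdelic (↥(maximalRealSubfield L)) L (IsCMField.complexConj L) 3 (qsForm L)) := ⟨rfl⟩
  haveI := 𝔳.hKo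
  haveI := 𝔥.hνGi
  obtain ⟨μG, hμG⟩ := exists_isAutomorphicMeasure_G3 L
  haveI := hμG
  set νfA : Measure (finAdelic (↥(maximalRealSubfield L)) L (IsCMField.complexConj L) 3 (qsForm L)) := @Measure.map _ _ 𝔳.msF _ (⇑(memberFinAdelicEquiv 𝔳).symm) 𝔳.νf
  haveI : νfA.IsHaarMeasure := isHaarMeasure_map_memberFinAdelicEquiv_symm 𝔳
  set νG : Measure (G3 L).Adelic := Measure.map (adelicProdEquiv (↥(maximalRealSubfield L)) L (IsCMField.complexConj L) 3 (qsForm L)).symm.toMulEquiv (𝔥.νGi.prod νfA) with hνGdef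
  haveI hνGH : νG.IsHaarMeasure := isHaarMeasure_map_adelicProdEquiv_symm_prod 𝔥 νfA
  exact ⟨μG, hμG, νG, hνGH, fun c πc hmem _ => memberFlath_of_archFinSplitG3Letter h6b 𝔥 𝔳 μG c πc hmem νG hνGdef⟩

end Glue

end Summit.HodgeConjecture.HodgeConjecture.R90.S10

end
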